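import Summits.PneNP.PneNP.Theorems.UniformStreamUniformMagnificationVariants160472
import HarnessLib

/-!
# Route UniformStream, crux `UniformMagnification` (stmt-PneNP-16047), line `registered`,
# stub `stub_padCore`, part C: the stage-A machines

**Theorem** (`stub_padCore`). For every guard constant `k` there are a constant `C` and two bundled
`TM2` machines `MA`, `MA'` over `{0, 1}` such that, writing a state word as
`ST = st·st ++ x y ++ rest` (`st` doubled bit by bit up to the first unequal pair `x ≠ y`):

* `MA` maps `⟨ST, b⟩ = boolPair ST [b]` to `⟨1 · ⟨st, [b]⟩, 1^{|rest|}⟩` if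
  `k (⌊log₂(|st|+1)⌋ + 1) ≤ ⌊log₂(|rest|+1)⌋` and to `⟨0 0, 1^{|rest|}⟩` otherwise, within
  `C (2|st| + |rest|) + C` steps, and a state word without unequal pair to `⟨0 0, ε⟩` within
  `C |st| + C` steps;
* `MA'` maps `ST` itself to `1 · st`, resp. `0 0`, resp. `0 0`, within the same bounds.

Proof. Both machines are compiled (`ACom.exists_computesInTime`, `SymbolPrograms.lean`) from the
structured stack programs of parts A and B (`UniformStreamUniformMagnificationVariants160471/2`):
`MA = prefixA ; scan ; post k ; finishA` and `MA' = (arm the flag) ; scan ; post k ; finishA'`,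
whose phases have exact final stores and linear costs (`PadCore.runs_prefixA`,
`PadCore.runs_scan_*`, `PadCore.runs_post`, `PadCore.runs_finishA_*`, `PadCore.runs_finishA'_*`);
the inputs are indexed by the three shapes of a state word (`PadCore.Shape`), and every cost is
at most `5 k |st| + 48 |st| + 35 |rest| + 5 k + 64`, whence `C = 5 k + 65`.

References: S. Arora, B. Barak, *Computational Complexity: A Modern Approach*, CUP 2009, §1.3
(Claim 1.6: low-level machine plumbing in linear time); T. Nipkow, G. Klein, *Concrete
Semantics*, Springer 2014, Ch. 7–8 (big-step semantics and compiler correctness, the verification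
style of `SymbolPrograms.lean`).
-/

namespace Summit.PneNP.PneNP.Cruxes.UniformMagnification.Birth

set_option linter.dupNamespace false -- `Summit.PneNP.PneNP.…`: summit = sub-problem (D-0017)

open _root_.Computability Literature.Computability.Complexity

namespace PadCore

open ACom

/-! ### Emission of the answer word of `MA'` -/

/-- `emitGoodA'`: the accepted answer word `1 · st` of `MA'` (the bits of `st` from `str`, last
bit first, then the head `1`), clearing the unused counter `r`. [folklore] -/
def emitGoodA' : Prog := pour .str .out ;; push .out true ;; clear .r

/-- Effect and cost of `emitGoodA'`: `3 |st| + 2 R + 3` steps. [folklore] -/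
theorem runs_emitGoodA' (st : List Bool) (R : ℕ) :
    Runs emitGoodA' (mk [] [] [] st.reverse [] (un R) [] [] [] [])
      (mk [] [] [] [] [] [] [] [] [] (true :: st)) (3 * st.length + 2 * R + 3) := by
  unfold emitGoodA'
  have h1 := runs_pour (Γ := Bool) (a := Rg.str) (b := Rg.out) (by decide)
    (mk [] [] [] st.reverse [] (un R) [] [] [] [])
  simp only [mk_str, mk_out, List.reverse_reverse, List.append_nil, update_mk_str, update_mk_out,
    List.length_reverse] at h1
  have h2 : Runs (push Rg.out true) (mk [] [] [] [] [] (un R) [] [] [] st)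
      (mk [] [] [] [] [] (un R) [] [] [] (true :: st)) 1 := Runs.push' (by simp)
  have h3 := runs_clear (Γ := Bool) Rg.r (mk [] [] [] [] [] (un R) [] [] [] (true :: st))
  simp only [mk_r, update_mk_r, List.length_replicate] at h3
  exact (h1.seq (h2.seq h3)).of_eq rfl (by omega)

/-- `emitBadA'`: the rejecting answer word `0 0` of `MA'` (after clearing the flag), clearing the
unused `str` and `r`. [folklore] -/
def emitBadA' : Prog := clear .fl ;; pushList .out [false, false] ;; clear .str ;; clear .r

/-- Effect and cost of `emitBadA'`: `2 |fl| + 2 |str| + 2 R + 5` steps. [folklore] -/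
theorem runs_emitBadA' (str fl : List Bool) (R : ℕ) :
    Runs emitBadA' (mk [] [] [] str [] (un R) [] [] fl [])
      (mk [] [] [] [] [] [] [] [] [] [false, false])
      (2 * fl.length + 2 * str.length + 2 * R + 5) := by
  unfold emitBadA'
  have h1 := runs_clear (Γ := Bool) Rg.fl (mk [] [] [] str [] (un R) [] [] fl [])
  simp only [mk_fl, update_mk_fl] at h1
  have h2 := runs_pushList (Γ := Bool) Rg.out [false, false] (mk [] [] [] str [] (un R) [] [] [] [])
  simp only [update_mk_out, mk_out, List.reverse_cons, List.reverse_nil, List.nil_append,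
    List.cons_append, List.length_cons, List.length_nil] at h2
  have h3 := runs_clear (Γ := Bool) Rg.str (mk [] [] [] str [] (un R) [] [] [] [false, false])
  simp only [mk_str, update_mk_str] at h3
  have h4 := runs_clear (Γ := Bool) Rg.r (mk [] [] [] [] [] (un R) [] [] [] [false, false])
  simp only [mk_r, update_mk_r, List.length_replicate] at h4
  exact (h1.seq (h2.seq (h3.seq h4))).of_eq rfl (by omega)

/-- The dispatch of `MA'` on the popped flag register: empty = accept. [folklore] -/
def dispatchA' : Option Bool → Prog
  | none => emitGoodA'
  | some _ => emitBadA'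

/-- `finishA'`: pop the flag register and emit the answer word of `MA'`. [folklore] -/
def finishA' : Prog := pop .fl dispatchA'

/-- `finishA'` with an empty flag register: `1 · st`, `3 |st| + 2 R + 5` steps. [folklore] -/
theorem runs_finishA'_good (st : List Bool) (R : ℕ) :
    Runs finishA' (mk [] [] [] st.reverse [] (un R) [] [] [] [])
      (mk [] [] [] [] [] [] [] [] [] (true :: st)) (3 * st.length + 2 * R + 3 + 2) :=
  Runs.pop_nil (k := Rg.fl) (f := dispatchA') rfl (runs_emitGoodA' st R)

/-- `finishA'` with a nonempty flag register: `0 0`, `2 |fl| + 2 |str| + 2 R + 7` steps.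
[folklore] -/
theorem runs_finishA'_bad (str fl : List Bool) (R : ℕ) :
    Runs finishA' (mk [] [] [] str [] (un R) [] [] (true :: fl) [])
      (mk [] [] [] [] [] [] [] [] [] [false, false])
      (2 * fl.length + 2 * str.length + 2 * R + 5 + 2) :=
  Runs.pop_cons' (k := Rg.fl) (f := dispatchA') (a := true) (w := fl)
    (R₀ := mk [] [] [] str [] (un R) [] [] fl []) rfl (by simp) (runs_emitBadA' str fl R)

/-! ### The programs and their inputs -/

/-- The program of `MA`: outer parse, scan, guard pipeline, emission. [folklore] -/
def progA (k : ℕ) : Prog := prefixA ;; scan ;; post k ;; finishA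

/-- The program of `MA'`: arm the flag, scan, guard pipeline, emission. [folklore] -/
def progA' (k : ℕ) : Prog := push .fl true ;; scan ;; post k ;; finishA'

/-- The three shapes of a state word: `st·st ++ x x̄ ++ rest` (a separator: the first unequal
pair), or without unequal pair, of even (`st·st`) or odd (`st·st ++ [c]`) length. [folklore] -/
inductive Shape
  | sep (st : List Bool) (x : Bool) (rest : List Bool)
  | nil (st : List Bool)
  | one (st : List Bool) (c : Bool)

/-- The state word of a shape. [folklore] -/
def Shape.word : Shape → List Bool
  | sep st x rest => SProg.dbl st ++ x :: (!x) :: rest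
  | nil st => SProg.dbl st
  | one st c => SProg.dbl st ++ [c]

/-- The length of the prefix `st` of a shape. [folklore] -/
def Shape.stLen : Shape → ℕ
  | sep st _ _ => st.length
  | nil st => st.length
  | one st _ => st.length

/-- The length of `rest` of a shape (`0` without separator). [folklore] -/
def Shape.restLen : Shape → ℕ
  | sep _ _ rest => rest.length
  | nil _ => 0
  | one _ _ => 0

/-- The answer word of `MA` on `⟨ST, b⟩`. [folklore] -/
def Shape.outA (k : ℕ) : Shape → Bool → List Bool
  | sep st _ rest, bb =>
    boolPair (if k * (Nat.log 2 (st.length + 1) + 1) ≤ Nat.log 2 (rest.length + 1)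
      then true :: boolPair st [bb] else [false, false]) (un rest.length)
  | nil _, _ => boolPair [false, false] []
  | one _ _, _ => boolPair [false, false] []

/-- The answer word of `MA'` on `ST`. [folklore] -/
def Shape.outA' (k : ℕ) : Shape → List Bool
  | sep st _ rest =>
    if k * (Nat.log 2 (st.length + 1) + 1) ≤ Nat.log 2 (rest.length + 1) then true :: st
      else [false, false]
  | nil _ => [false, false]
  | one _ _ => [false, false]

/-- The common step bound of both programs on a shape with `|st| = n`, `|rest| = R`. [folklore] -/
def cost (k n R : ℕ) : ℕ := 5 * (k * n) + 48 * n + 35 * R + 5 * k + 64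

/-- The flag count after `post k` in the rejecting case is positive; its predecessor. [folklore] -/
theorem flagCount_eq (k n R : ℕ) (hg : ¬ k * (Nat.log 2 (n + 1) + 1) ≤ Nat.log 2 (R + 1)) :
    k * (Nat.log 2 (n + 1) + 1) - Nat.log 2 (R + 1) =
      (k * (Nat.log 2 (n + 1) + 1) - Nat.log 2 (R + 1) - 1) + 1 := by
  omega

/-- Arithmetic of the flag count: `k (⌊log₂(n+1)⌋ + 1) ≤ k n + k`. [folklore] -/
theorem flagCount_le (k n R : ℕ) : k * (Nat.log 2 (n + 1) + 1) - Nat.log 2 (R + 1) ≤ k * n + k := by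
  have ha := (Nat.log_lt_iff_lt_pow one_lt_two (Nat.add_one_ne_zero n)).2
    (Nat.lt_two_pow_self (n := n + 1))
  have hk : k * (Nat.log 2 (n + 1) + 1) = k * Nat.log 2 (n + 1) + k := mul_add_one k _
  have hkn : k * Nat.log 2 (n + 1) ≤ k * n := Nat.mul_le_mul_left k (by omega)
  omega

/-! ### The runs of `MA` -/

/-- **`MA` on its three input shapes**: exact output, cost `≤ cost k |st| |rest|`. [folklore] -/
theorem runs_progA (k : ℕ) : ∀ (σ : Shape) (bb : Bool),
    Runs (progA k) (AStore.single .inp (boolPair σ.word [bb]))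
      (AStore.single .out (σ.outA k bb)) (cost k σ.stLen σ.restLen)
  | .sep st x rest, bb => by
    rw [single_inp, single_out]
    simp only [Shape.word, Shape.outA, Shape.stLen, Shape.restLen, cost]
    unfold progA
    have h1 := runs_prefixA (SProg.dbl st ++ x :: (!x) :: rest) bb
    have h2 := runs_scan_sep [] [bb] [] [] [] [] [] st x rest
    simp only [List.append_nil] at h2
    have h3 := runs_post k [bb] st.reverse (un rest.length) [] [] st.length rest.length
    simp only [List.append_nil] at h3
    have hfl := flagCount_le k st.length rest.length
    have hlen : (SProg.dbl st ++ x :: (!x) :: rest).length = 2 * st.length + 2 + rest.length := by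
      simp only [List.length_append, SProg.length_dbl, List.length_cons]; omega
    rw [hlen] at h1
    by_cases hg : k * (Nat.log 2 (st.length + 1) + 1) ≤ Nat.log 2 (rest.length + 1)
    · rw [if_pos hg]
      rw [Nat.sub_eq_zero_of_le hg] at h3
      have h4 := runs_finishA_good st bb rest.length
      exact (h1.seq (h2.seq (h3.seq h4))).of_eq rfl (by omega)
    · rw [if_neg hg]
      rw [flagCount_eq k st.length rest.length hg] at h3
      have h4 := runs_finishA_bad st.reverse
        (un (k * (Nat.log 2 (st.length + 1) + 1) - Nat.log 2 (rest.length + 1) - 1)) bb rest.length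
      simp only [List.length_replicate, List.length_reverse] at h4
      exact (h1.seq (h2.seq (h3.seq h4))).of_eq rfl (by omega)
  | .nil st, bb => by
    rw [single_inp, single_out]
    simp only [Shape.word, Shape.outA, Shape.stLen, Shape.restLen, cost]
    unfold progA
    have h1 := runs_prefixA (SProg.dbl st) bb
    rw [SProg.length_dbl] at h1
    have h2 := runs_scan_nil [] [bb] [] [] [] [true] [] st
    have h3 := runs_post k [bb] st.reverse [] [true] [] st.length 0
    simp only [Nat.zero_add, Nat.log_one_right, Nat.sub_zero, un_append_cons, List.append_nil]
      at h3
    have hfl := flagCount_le k st.length 0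
    simp only [Nat.zero_add, Nat.log_one_right, Nat.sub_zero] at hfl
    have h4 := runs_finishA_bad st.reverse (un (k * (Nat.log 2 (st.length + 1) + 1))) bb 0
    simp only [List.length_replicate, List.length_reverse] at h4
    exact (h1.seq (h2.seq (h3.seq h4))).of_eq rfl (by omega)
  | .one st c, bb => by
    rw [single_inp, single_out]
    simp only [Shape.word, Shape.outA, Shape.stLen, Shape.restLen, cost]
    unfold progA
    have h1 := runs_prefixA (SProg.dbl st ++ [c]) bb
    rw [List.length_append, SProg.length_dbl, List.length_singleton] at h1
    have h2 := runs_scan_one [] [bb] [] [] [] [true] [] st c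
    have h3 := runs_post k [bb] st.reverse [] [true] [] st.length 0
    simp only [Nat.zero_add, Nat.log_one_right, Nat.sub_zero, un_append_cons, List.append_nil]
      at h3
    have hfl := flagCount_le k st.length 0
    simp only [Nat.zero_add, Nat.log_one_right, Nat.sub_zero] at hfl
    have h4 := runs_finishA_bad st.reverse (un (k * (Nat.log 2 (st.length + 1) + 1))) bb 0
    simp only [List.length_replicate, List.length_reverse] at h4
    exact (h1.seq (h2.seq (h3.seq h4))).of_eq rfl (by omega)

/-! ### The runs of `MA'` -/

/-- **`MA'` on its three input shapes**: exact output, cost `≤ cost k |st| |rest|`. [folklore] -/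
theorem runs_progA' (k : ℕ) : ∀ σ : Shape,
    Runs (progA' k) (AStore.single .inp σ.word) (AStore.single .out (σ.outA' k))
      (cost k σ.stLen σ.restLen)
  | .sep st x rest => by
    rw [single_inp, single_out]
    simp only [Shape.word, Shape.outA', Shape.stLen, Shape.restLen, cost]
    unfold progA'
    have h1 : Runs (push Rg.fl true)
        (mk (SProg.dbl st ++ x :: (!x) :: rest) [] [] [] [] [] [] [] [] [])
        (mk (SProg.dbl st ++ x :: (!x) :: rest) [] [] [] [] [] [] [] [true] []) 1 :=
      Runs.push' (by simp)
    have h2 := runs_scan_sep [] [] [] [] [] [] [] st x rest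
    simp only [List.append_nil] at h2
    have h3 := runs_post k [] st.reverse (un rest.length) [] [] st.length rest.length
    simp only [List.append_nil] at h3
    have hfl := flagCount_le k st.length rest.length
    by_cases hg : k * (Nat.log 2 (st.length + 1) + 1) ≤ Nat.log 2 (rest.length + 1)
    · rw [if_pos hg]
      rw [Nat.sub_eq_zero_of_le hg] at h3
      have h4 := runs_finishA'_good st rest.length
      exact (h1.seq (h2.seq (h3.seq h4))).of_eq rfl (by omega)
    · rw [if_neg hg]
      rw [flagCount_eq k st.length rest.length hg] at h3
      have h4 := runs_finishA'_bad st.reverse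
        (un (k * (Nat.log 2 (st.length + 1) + 1) - Nat.log 2 (rest.length + 1) - 1)) rest.length
      simp only [List.length_replicate, List.length_reverse] at h4
      exact (h1.seq (h2.seq (h3.seq h4))).of_eq rfl (by omega)
  | .nil st => by
    rw [single_inp, single_out]
    simp only [Shape.word, Shape.outA', Shape.stLen, Shape.restLen, cost]
    unfold progA'
    have h1 : Runs (push Rg.fl true) (mk (SProg.dbl st) [] [] [] [] [] [] [] [] [])
        (mk (SProg.dbl st) [] [] [] [] [] [] [] [true] []) 1 := Runs.push' (by simp)
    have h2 := runs_scan_nil [] [] [] [] [] [true] [] st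
    have h3 := runs_post k [] st.reverse [] [true] [] st.length 0
    simp only [Nat.zero_add, Nat.log_one_right, Nat.sub_zero, un_append_cons, List.append_nil]
      at h3
    have hfl := flagCount_le k st.length 0
    simp only [Nat.zero_add, Nat.log_one_right, Nat.sub_zero] at hfl
    have h4 := runs_finishA'_bad st.reverse (un (k * (Nat.log 2 (st.length + 1) + 1))) 0
    simp only [List.length_replicate, List.length_reverse] at h4
    exact (h1.seq (h2.seq (h3.seq h4))).of_eq rfl (by omega)
  | .one st c => by
    rw [single_inp, single_out]
    simp only [Shape.word, Shape.outA', Shape.stLen, Shape.restLen, cost]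
    unfold progA'
    have h1 : Runs (push Rg.fl true) (mk (SProg.dbl st ++ [c]) [] [] [] [] [] [] [] [] [])
        (mk (SProg.dbl st ++ [c]) [] [] [] [] [] [] [] [true] []) 1 := Runs.push' (by simp)
    have h2 := runs_scan_one [] [] [] [] [] [true] [] st c
    have h3 := runs_post k [] st.reverse [] [true] [] st.length 0
    simp only [Nat.zero_add, Nat.log_one_right, Nat.sub_zero, un_append_cons, List.append_nil]
      at h3
    have hfl := flagCount_le k st.length 0
    simp only [Nat.zero_add, Nat.log_one_right, Nat.sub_zero] at hfl
    have h4 := runs_finishA'_bad st.reverse (un (k * (Nat.log 2 (st.length + 1) + 1))) 0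
    simp only [List.length_replicate, List.length_reverse] at h4
    exact (h1.seq (h2.seq (h3.seq h4))).of_eq rfl (by omega)

/-! ### The machines -/

/-- **The machine `MA`** (compiled from `progA k`). [folklore] -/
theorem exists_MA (k : ℕ) : ∃ MA : Turing.TM2ComputableAux Bool Bool, ∀ (σ : Shape) (bb : Bool),
    MA.OutputsWithin (boolPair σ.word [bb]) (σ.outA k bb) (cost k σ.stLen σ.restLen + 1) := by
  obtain ⟨M, hM⟩ := ACom.exists_computesInTime (progA k) .inp .out
    (fun p : Shape × Bool => boolPair p.1.word [p.2]) (fun p : Shape × Bool => p.1.outA k p.2) id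
    (fun p => cost k p.1.stLen p.1.restLen) (fun p => runs_progA k p.1 p.2)
  exact ⟨M, fun σ bb => hM (σ, bb)⟩

/-- **The machine `MA'`** (compiled from `progA' k`). [folklore] -/
theorem exists_MA' (k : ℕ) : ∃ MA' : Turing.TM2ComputableAux Bool Bool, ∀ σ : Shape,
    MA'.OutputsWithin σ.word (σ.outA' k) (cost k σ.stLen σ.restLen + 1) := by
  obtain ⟨M, hM⟩ := ACom.exists_computesInTime (progA' k) .inp .out
    Shape.word (Shape.outA' k) id (fun σ => cost k σ.stLen σ.restLen) (runs_progA' k)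
  exact ⟨M, fun σ => hM σ⟩

end PadCore

/-! ### The stub -/

open PadCore in
/-- **stub_padCore** — the linear-time STAGE-A machines of the padded streaming update: for every
guard constant `k`, one constant `C = 5 k + 65` and two `TM2` machines `MA` (on `⟨ST, b⟩`) and
`MA'` (on `ST`) which re-parse the state word `ST = st·st ++ x y ++ rest` up to its first unequal
pair, evaluate the guard `k (⌊log₂(|st|+1)⌋ + 1) ≤ ⌊log₂(|rest|+1)⌋` and emit
`⟨1 · ⟨st, [b]⟩ | 0 0, 1^{|rest|}⟩`, resp. `1 · st | 0 0`, a state word without unequal pair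
being answered `⟨0 0, ε⟩`, resp. `0 0`; all within `C (2|st| + |rest|) + C`, resp. `C |st| + C`
steps. The machines are compiled structured stack programs (`PadCore.progA`, `PadCore.progA'`,
`ACom.exists_computesInTime`). [cite: AroraBarakCC2009, §1.3 (Claim 1.6)] -/
theorem stub_padCore (k : ℕ) :
    ∃ (C : ℕ) (MA MA' : Turing.TM2ComputableAux Bool Bool),
      (∀ (st rest : List Bool) (x y b : Bool), x ≠ y →
        MA.OutputsWithin (boolPair (st.flatMap (fun c => [c, c]) ++ x :: y :: rest) [b])
          (boolPair (if k * (Nat.log 2 (st.length + 1) + 1) ≤ Nat.log 2 (rest.length + 1)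
              then true :: boolPair st [b] else [false, false])
            (List.replicate rest.length true))
          (C * (2 * st.length + rest.length) + C)) ∧
      (∀ (st tl : List Bool) (b : Bool), tl.length ≤ 1 →
        MA.OutputsWithin (boolPair (st.flatMap (fun c => [c, c]) ++ tl) [b]) (boolPair [false, false] [])
          (C * st.length + C)) ∧
      (∀ (st rest : List Bool) (x y : Bool), x ≠ y →
        MA'.OutputsWithin (st.flatMap (fun c => [c, c]) ++ x :: y :: rest)
          (if k * (Nat.log 2 (st.length + 1) + 1) ≤ Nat.log 2 (rest.length + 1)
            then true :: st else [false, false])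
          (C * (2 * st.length + rest.length) + C)) ∧
      (∀ (st tl : List Bool), tl.length ≤ 1 →
        MA'.OutputsWithin (st.flatMap (fun c => [c, c]) ++ tl) [false, false] (C * st.length + C)) := by
  obtain ⟨MA, hMA⟩ := exists_MA k
  obtain ⟨MA', hMA'⟩ := exists_MA' k
  have hC : ∀ n R : ℕ, cost k n R + 1 ≤ (5 * k + 65) * (2 * n + R) + (5 * k + 65) := by
    intro n R
    have e : (5 * k + 65) * (2 * n + R) + (5 * k + 65) =
        10 * (k * n) + 5 * (k * R) + 130 * n + 65 * R + 5 * k + 65 := by ring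
    rw [e, cost]
    omega
  have hC' : ∀ n : ℕ, cost k n 0 + 1 ≤ (5 * k + 65) * n + (5 * k + 65) := by
    intro n
    have e : (5 * k + 65) * n + (5 * k + 65) = 5 * (k * n) + 65 * n + 5 * k + 65 := by ring
    rw [e, cost]
    omega
  refine ⟨5 * k + 65, MA, MA', ?_, ?_, ?_, ?_⟩
  · intro st rest x y b hxy
    have hy : y = !x := by revert hxy; cases x <;> cases y <;> decide
    subst hy
    exact (hMA (.sep st x rest) b).mono (hC st.length rest.length)
  · intro st tl b htl
    match tl, htl with
    | [], _ =>
      rw [List.append_nil]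
      exact (hMA (.nil st) b).mono (hC' st.length)
    | [c], _ => exact (hMA (.one st c) b).mono (hC' st.length)
    | _ :: _ :: _, h => simp at h
  · intro st rest x y hxy
    have hy : y = !x := by revert hxy; cases x <;> cases y <;> decide
    subst hy
    exact (hMA' (.sep st x rest)).mono (hC st.length rest.length)
  · intro st tl htl
    match tl, htl with
    | [], _ =>
      rw [List.append_nil]
      exact (hMA' (.nil st)).mono (hC' st.length)
    | [c], _ => exact (hMA' (.one st c)).mono (hC' st.length)
    | _ :: _ :: _, h => simp at h

end Summit.PneNP.PneNP.Cruxes.UniformMagnification.Birth
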